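import Summits.BirchSwinnertonDyer.BirchSwinnertonDyer.Theses.KolyvaginRankRigidityAtTwo
import Summits.BirchSwinnertonDyer.BirchSwinnertonDyer.Theorems.KolyvaginRankRigidityAtTwoKolyvaginNonvanishingAtTwoFrameNonTorsionLevelOne
import HarnessLib

/-!
# Crux V1′∞ `KolyvaginStrongNonzeroSystemAtTwo` (stmt-BirchSwinnertonDyer-27983): the NON-TORSION half —
# a frame whose level-one derived point `P(1)` (= `y_K`) has infinite order carries a RICH depth `r = 0`
# (helper, PROVED, unconditional; width seat `bsd-line-krr2-p2` g8)

V1′∞ (pen g7, R4-∞) asks, on the habitat and for every frame `(Dt, β, ι)`, for a depth `r` such that for EVERY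
relative margin `(θ, k)` some Kolyvagin class `c_M(n) ≠ 0` has depth exactly `r`, `1 ≤ M` and `θ·M + k ≤ M(n)`.
When some conductor-`1` datum has `P(1)` of infinite order, `r = 0` serves: `n = 1` has no prime factor,
`M(1) = ∞` frees every margin, and `c_M(1) ≠ 0` at a level `M ≥ 1` with `2^M ∤ P(1)` in `E(K[1])`
(Mordell–Weil over `K[1]`, admissibility at `2` on the habitat, `Γ_K`-invariance of `P(1)`, McCallum Cor. 4.5 —
the road of the landed `KolyvaginAtTwo.stub_nonTorsionLevelOne` / `stub_nonTorsionLevelOneTheta`, krr2-p2 g6).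
So V1′∞ is the statement about the TORSION-`y_K` frames only (Kolyvagin's conjecture at `2`, strong form), which
is NOT touched here. `--supports stmt-BirchSwinnertonDyer-27983` (helper); V1′∞ is not proved; the
Birch–Swinnerton-Dyer conjecture is NOT proved by any of this.

References: [GrossLMS1991] §2, §4 (4.1), Prop. 4.7 (1); [McCallumLMS1991] §4 Cor. 4.5, §5 Lemma 5.1;
[Kolyvagin1991MathAnn] p. 257 (relative margins), p. 259 (2.1).
-/

set_option autoImplicit false
-- the Theorems namespace of this sub repeats the summit name by design (D-0017 nested layout)
set_option linter.dupNamespace false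

noncomputable section

open scoped Classical

open WeierstrassCurve Field Literature.NumberTheory.EllipticCurves
  Literature.NumberTheory.EllipticCurves.ModularForms
open Summit.BirchSwinnertonDyer.BirchSwinnertonDyer.Theses.KolyvaginRankRigidityAtTwo

namespace Summit.BirchSwinnertonDyer.BirchSwinnertonDyer.Theorems.KolyvaginAtTwo

/-- **V1′∞ on a frame with `P(1)` of infinite order, rich depth `r = 0`** (the item's binders VERBATIM, then the
non-torsion hypothesis): for every `θ, k` there is a non-zero class `c_M(1) ≠ 0` of depth `0`, `1 ≤ M`, with
`θ M + k ≤ M(1) = ∞`. [cite: GrossLMS1991, §2, Prop. 4.7 (1)] [cite: McCallumLMS1991, §4 Cor. 4.5, §5 Lemma 5.1]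
[cite: Kolyvagin1991MathAnn, p. 259 (2.1)] -/
theorem strongNonzeroSystemAtTwo_depthZero_of_nonTorsion :
    ∀ (W : WeierstrassCurve ℚ) [W.IsElliptic] [W.IsGloballyMinimal], ¬ W.HasCM →
      (Literature.NumberTheory.EllipticCurves.Rank1Residual.GoodOrd W 2 ∨
        Literature.NumberTheory.EllipticCurves.Rank1Residual.Mult W 2) →
      (∀ m : ℕ, W.HasSurjectiveModNGaloisRep (2 ^ m : ℕ)) →
      ∀ (K : Type) [Field K] [NumberField K], Literature.NumberTheory.EllipticCurves.IsImaginaryQuadratic K →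
      ∀ [NeZero (W.conductorNorm ℤ)],
      Literature.NumberTheory.EllipticCurves.SatisfiesHeegnerHypothesis (W.conductorNorm ℤ) K →
      Odd (NumberField.discr K) → NumberField.discr K ≠ -3 →
      AddSubgroup.torsionBy (W.baseChange K).toAffine.Point (2 : ℤ) = ⊥ →
      Literature.NumberTheory.EllipticCurves.SatisfiesHeegnerHypothesis 2 K →
      ∀ (Dt : Literature.NumberTheory.EllipticCurves.ModularForms.ModularParametrizationData W (W.conductorNorm ℤ))
        (β : ℤ) (ι : K →+* ℂ), (4 * (W.conductorNorm ℤ : ℤ)) ∣ β ^ 2 - NumberField.discr K →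
      (∃ d₁ : Literature.NumberTheory.EllipticCurves.KolyvaginHeegnerData Dt β ι 1, ¬ IsOfFinAddOrder d₁.derivedPoint) →
      ∀ θ k : ℕ, ∃ (n : ℕ) (d : Literature.NumberTheory.EllipticCurves.KolyvaginHeegnerData Dt β ι n) (M : ℕ),
        Literature.NumberTheory.EllipticCurves.KolyvaginDescent.KolSupp
          (Literature.NumberTheory.EllipticCurves.Zhang2014.IsKolyvaginPrime (W.conductorNorm ℤ) W K 2) n ∧
        n.primeFactors.card = 0 ∧ 1 ≤ M ∧
        ((θ * M + k : ℕ) : ℕ∞) ≤ Literature.NumberTheory.EllipticCurves.Zhang2014.levelIndex W 2 n ∧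
        d.kolyvaginClass Nat.prime_two M ≠ 0 := by
  intro W _ _ _ _ hsur K _ _ hK _ hHN hodd _ _ _ Dt β ι _ hex θ k
  obtain ⟨d₁, hnt⟩ := hex
  have hs : W.HasSurjectiveModNGaloisRep 2 := by simpa using hsur 1
  -- `E(K[1])` is finitely generated (Mordell–Weil over the number field `K[1]`)
  haveI := (finiteDimensional_and_isGalois_ringClassField hK ι one_ne_zero).1
  haveI : NumberField (ringClassField K ι 1) := NumberField.of_module_finite K _
  haveI : (W.baseChange (ringClassField K ι 1)).IsElliptic := by rw [baseChange]; infer_instance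
  haveI : Module.Finite ℤ (W.baseChange (ringClassField K ι 1)).toAffine.Point := by
    convert (W.baseChange (ringClassField K ι 1)).module_finite_point_holds
  -- a level `M ≥ 1` with `2^M ∤ P(1)`
  obtain ⟨M, hM1, hndiv⟩ := exists_not_two_pow_zsmul_eq
    (A := (W.baseChange (ringClassField K ι 1)).toAffine.Point) (y := d₁.derivedPoint) (by convert hnt)
  refine ⟨1, d₁, M, KolyvaginDescent.kolSupp_one _, by simp, hM1, by simp, ?_⟩
  refine (Summit.BirchSwinnertonDyer.Rank1Residual.X11b.Three.KolyCert.kolyvaginClass_ne_zero_iff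
    d₁ Nat.prime_two M).mpr ⟨?_, ?_, ?_⟩
  · exact isAdmissible_pointsSubgroup_two_of_heegner d₁ hs hK hodd hHN one_ne_zero M
  · exact toGeomPoints_derivedPoint_one_mem_invPoints hK hHN d₁ _
  · rintro ⟨Q, hQ⟩
    exact hndiv ⟨Q, by convert hQ⟩

/-- **The non-torsion half of V1′∞, in the item's shape**: on a frame with `P(1)` of infinite order the item's
conclusion `∃ r, ∀ θ k, …` holds with `r = 0`. (The torsion-`y_K` frames — Kolyvagin's conjecture at `2`, strong
form — are the content of V1′∞ and are not touched.) [cite: Kolyvagin1991MathAnn, p. 259 (2.1), Conj. 2.5]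
[cite: GrossLMS1991, Prop. 4.7 (1)] -/
theorem strongNonzeroSystemAtTwo_of_nonTorsion :
    ∀ (W : WeierstrassCurve ℚ) [W.IsElliptic] [W.IsGloballyMinimal], ¬ W.HasCM →
      (Literature.NumberTheory.EllipticCurves.Rank1Residual.GoodOrd W 2 ∨
        Literature.NumberTheory.EllipticCurves.Rank1Residual.Mult W 2) →
      (∀ m : ℕ, W.HasSurjectiveModNGaloisRep (2 ^ m : ℕ)) →
      ∀ (K : Type) [Field K] [NumberField K], Literature.NumberTheory.EllipticCurves.IsImaginaryQuadratic K →
      ∀ [NeZero (W.conductorNorm ℤ)],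
      Literature.NumberTheory.EllipticCurves.SatisfiesHeegnerHypothesis (W.conductorNorm ℤ) K →
      Odd (NumberField.discr K) → NumberField.discr K ≠ -3 →
      AddSubgroup.torsionBy (W.baseChange K).toAffine.Point (2 : ℤ) = ⊥ →
      Literature.NumberTheory.EllipticCurves.SatisfiesHeegnerHypothesis 2 K →
      ∀ (Dt : Literature.NumberTheory.EllipticCurves.ModularForms.ModularParametrizationData W (W.conductorNorm ℤ))
        (β : ℤ) (ι : K →+* ℂ), (4 * (W.conductorNorm ℤ : ℤ)) ∣ β ^ 2 - NumberField.discr K →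
      (∃ d₁ : Literature.NumberTheory.EllipticCurves.KolyvaginHeegnerData Dt β ι 1, ¬ IsOfFinAddOrder d₁.derivedPoint) →
      ∃ r : ℕ, ∀ θ k : ℕ, ∃ (n : ℕ) (d : Literature.NumberTheory.EllipticCurves.KolyvaginHeegnerData Dt β ι n) (M : ℕ),
        Literature.NumberTheory.EllipticCurves.KolyvaginDescent.KolSupp
          (Literature.NumberTheory.EllipticCurves.Zhang2014.IsKolyvaginPrime (W.conductorNorm ℤ) W K 2) n ∧
        n.primeFactors.card = r ∧ 1 ≤ M ∧
        ((θ * M + k : ℕ) : ℕ∞) ≤ Literature.NumberTheory.EllipticCurves.Zhang2014.levelIndex W 2 n ∧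
        d.kolyvaginClass Nat.prime_two M ≠ 0 :=
  fun W _ _ hCM hred hsur K _ _ hK _ hHN hodd hne3 htor hH2 Dt β ι hβ hex ↦
    ⟨0, strongNonzeroSystemAtTwo_depthZero_of_nonTorsion W hCM hred hsur K hK hHN hodd hne3 htor hH2 Dt β ι hβ
      hex⟩

end Summit.BirchSwinnertonDyer.BirchSwinnertonDyer.Theorems.KolyvaginAtTwo

end
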